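import Summits.ValiantsHypothesis.ValiantsHypothesis.Theses.BarrierLever
import Literature.Barriers.ValiantsHypothesis.CKRST20IntegerBoxNaturalProofs

/-!
# Route BarrierLever — item 20032 `NoBoxTransferBelowLevel` (coefficient axis of the V4 door)

Item `stmt-ValiantsHypothesis-20032` (support, rank 9; planner p2-g7, cell valiant-natproofs, rung V4;
crux stmt-ValiantsHypothesis-14610 = FSV Question 6 appears ONLY as antecedent — a consequence of the crux
filed as the LOWER end of the transfer-threshold bracket, not progress on it). NO BOX TRANSFER BELOW THE
LEVEL: under Q6, for every `a₀` the uniform VANISHING TRANSFER at level `a₀ + 6` from the integer box of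
magnitude `N^{a₀}` (`N = C(2n,n)`) fails.

**Proof** (planner p2-g7's, re-derived because the attached scratch is not readable from a prover jail):
Q6 at level `a₀ + 6` gives a size exponent `b` such that `SmallCircuits ℂ n b` hits every nonzero
level-`(a₀+6)` distinguisher for large `n`; the transfer hypothesis at `b` gives `b'`; CKRST'20 Thm 1.6
in its integer-box form (tree: `CKRST2020.intBox_frame a₀ b'`) gives, for large `n`, a level-`(a₀+6)`
distinguisher `D` vanishing on `SmallCircuits ℂ n b' ∩ box(N^{a₀})` and nonzero somewhere; the transfer
makes `D` vanish on all of `SmallCircuits ℂ n b`, contradicting the hitting-set property.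

WHAT THIS IS NOT: nothing on Q6 / crux 14610 itself (it is the antecedent), nothing on VP vs VNP.
-/

-- layout Summits/ValiantsHypothesis/ValiantsHypothesis forces the duplicated namespace component
set_option linter.dupNamespace false

namespace Summit.ValiantsHypothesis.ValiantsHypothesis.Theorems.BarrierLever.CoeffAxis

open MvPolynomial Literature.Barriers.ValiantsHypothesis

/-- **Item 20032 `NoBoxTransferBelowLevel`** (the route decl, by name). -/
theorem noBoxTransferBelowLevel : Theses.BarrierLever.NoBoxTransferBelowLevel := by
  intro hQ6 a₀ htr
  obtain ⟨b, n₀, hhs⟩ := hQ6 (a₀ + 6)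
  obtain ⟨b', n₁, htr'⟩ := htr b
  obtain ⟨n₂, hfr⟩ := CKRST2020.intBox_frame a₀ b'
  obtain ⟨D, ⟨hD𝒟, ⟨g, -, hgD⟩, hvan⟩, -⟩ :=
    hfr (max n₀ (max n₁ n₂)) ((le_max_right _ _).trans (le_max_right _ _))
  have hD0 : D ≠ 0 := fun h => hgD (by rw [h, map_zero])
  -- the transfer: `D` kills all of `SmallCircuits ℂ n b`
  have hkill : ∀ f ∈ SmallCircuits ℂ (max n₀ (max n₁ n₂)) b,
      eval (coeffVector (degLEMonomials (max n₀ (max n₁ n₂))) f) D = 0 :=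
    htr' (max n₀ (max n₁ n₂)) ((le_max_left _ _).trans (le_max_right _ _)) D hD𝒟
      (fun f hf hbox => hvan f hf hbox)
  -- Q6: some small circuit is a non-root
  obtain ⟨f, hf, hfD⟩ := hhs (max n₀ (max n₁ n₂)) (le_max_left _ _) D hD𝒟 hD0
  exact hfD (hkill f hf)

end Summit.ValiantsHypothesis.ValiantsHypothesis.Theorems.BarrierLever.CoeffAxis
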